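import Literature.RingTheory.HilbertSamuel.TangentConeChangeOfGenerators
import Mathlib.LinearAlgebra.FreeModule.PID
import Mathlib.RingTheory.Localization.Module
import HarnessLib

/-!
# The directrix under specialization in a saturated family over a principal ideal domain:
# `dim_k 𝒯(N ⊗ k) ≤ dim_K 𝒯(N ⊗ K)` (Cossart–Jannsen–Saito 2020, Lemma 3.8 / Claim 3.9, the core of Thm. 3.7)

Topic: `Literature/RingTheory/MvPolynomial`. CJS, LNM 2270, proof of Thm. 3.7 (p. 45–46): for a regular local ring `R`,
an ideal `J` and a prime `𝔭 ⊇ J` with `A = R/𝔭` a discrete valuation ring (`dim A = 1`) and `R/J` normally flat along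
`𝔭`, write `K = Frac(A)`, `k = A/𝔪_A`. The ideal `In_𝔭(J) ⊆ gr_𝔭(R) = A[X_1, …, X_m]` is SATURATED (`In_𝔭(J)_K ∩ gr_𝔭(R)
= In_𝔭(J)`, by flatness), its generic fibre `In_𝔭(J)_K` is the tangent cone ideal of `R_𝔭/J_𝔭` and its special fibre is
the ideal of the normal-cone fibre. **Lemma 3.8 / Claim 3.9**: if the `K`-subspace `V = 𝒯(In_𝔭(J)_K)` (the directrix)
is `T_K` for a direct summand `T ⊆ gr¹_𝔭(R) = A^m` («satisfied if `dim(A) = 1`, by the theory of elementary divisors»),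
then `In_𝔭(J) = (A[T] ∩ In_𝔭(J)) · gr_𝔭(R)` — proved by expanding in the monomials of a complementary basis `Z` and
using saturation coefficientwise — so the special fibre is generated inside `k[T̄]` and its directrix has dimension
`≤ rk T = dim_K V`.

This file proves that statement as a self-contained theorem of polynomial algebra over a PID:

* **`finrank_directrixSpace_map_le_of_saturated`** — for `R` a principal ideal domain with fraction field `K`, any ring
  homomorphism `π : R → k` to a field, and an ideal `N ⊆ R[X_1, …, X_m]` which is SATURATED (`c ≠ 0`, `c·φ ∈ N ⇒ φ ∈ N`):
  `dim_k 𝒯(N · k[X]) ≤ dim_K 𝒯(N · K[X])` (CJS Lemma 2.7 directrix spaces `directrixSpace` of `Directrix.lean`);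
  equivalently `e(K[X]/N K[X]) ≤ e(k[X]/N k[X])`.

Steps (all proved here): `exists_denom_mul_eq_map` (clearing denominators of a polynomial over `Frac R`),
`mem_of_map_mem_map_of_saturated` (`N·K[X] ∩ R[X] = N`, CJS (3.6)), `map_stripRForm` (the `Z`-expansion coefficients
`c_α` of `Directrix.lean` have `R`-forms), `le_span_inter_supported_of_saturated` (**Claim 3.9**: if the generic fibre is
generated in the variables `X_A`, so is `N`, hence so is every fibre), `linSubst_linForm` (a linear substitution acts on
linear forms through the transposed matrix), and the Smith-normal-form coordinate change (Mathlib
`Submodule.smithNormalForm`) making `𝒯(N·K[X]) ∩ R^m` a coordinate summand (**Lemma 3.8**'s hypothesis over a PID).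

Written for the cell res-hironaka (HIRONAKA-L, librarian seat res-D-lib-1; consumer: the discharge of
`CossartJannsenSaito2020_thm_3_7`, F-64). AI-written; AI review is weaker than expert review.

## References

* V. Cossart, U. Jannsen, S. Saito, *Desingularization: Invariants and Strategy*, LNM 2270 (2020), Ch. 3, Thm. 3.7,
  Lemma 3.8, Claim 3.9, (3.4)–(3.6) (p. 45–46); Lemma 2.7. [CossartJannsenSaito2020]
-/

noncomputable section

open MvPolynomial Module
open Literature.AlgebraicGeometry.Resolution

namespace Literature.RingTheory.MvPolynomial

universe u v w

variable {R : Type u} [CommRing R] {m : ℕ}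

/-! ## Clearing denominators over the fraction field -/

section Fractions

variable {K : Type v} [Field K] [Algebra R K] [IsFractionRing R K] [IsDomain R]

/-- **Clearing denominators**: every polynomial over `K = Frac(R)` becomes a polynomial over `R` after multiplication by
a non-zero constant of `R` (the step «there exists `c ∈ A` such that `cφ = Σ a_i ψ_i`» of CJS's proof).
[cite: CossartJannsenSaito2020, Thm. 3.7 (proof, (3.4)–(3.6))] -/
theorem exists_denom_mul_eq_map (g : MvPolynomial (Fin m) K) :
    ∃ d : R, d ≠ 0 ∧ ∃ h : MvPolynomial (Fin m) R, C (algebraMap R K d) * g = MvPolynomial.map (algebraMap R K) h := by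
  classical
  induction g using MvPolynomial.induction_on with
  | C κ =>
    obtain ⟨⟨r, s⟩, hrs⟩ := IsLocalization.surj (nonZeroDivisors R) κ
    refine ⟨s, nonZeroDivisors.ne_zero s.2, C r, ?_⟩
    rw [map_C, ← C_mul, mul_comm]
    exact congrArg C hrs
  | add p q hp hq =>
    obtain ⟨d₁, hd₁, h₁, h₁eq⟩ := hp
    obtain ⟨d₂, hd₂, h₂, h₂eq⟩ := hq
    refine ⟨d₁ * d₂, mul_ne_zero hd₁ hd₂, C d₂ * h₁ + C d₁ * h₂, ?_⟩
    simp only [map_add, map_mul, map_C]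
    rw [← h₁eq, ← h₂eq]
    ring
  | mul_X p i hp =>
    obtain ⟨d, hd, h, heq⟩ := hp
    refine ⟨d, hd, h * X i, ?_⟩
    rw [map_mul, map_X, ← heq, mul_assoc]

/-- **`N · K[X] ∩ R[X] = N` for a saturated ideal `N ⊆ R[X]`** (CJS (3.6): «the flatness of `gr_𝔭(R/J)` implies
`In_𝔭(J)_K ∩ gr_𝔭(R) = In_𝔭(J)`»): if `c ≠ 0`, `c φ ∈ N ⇒ φ ∈ N`, then an `R`-polynomial whose image lies in the
extended ideal `N · K[X]` lies in `N`. [cite: CossartJannsenSaito2020, Thm. 3.7 (proof, (3.6))] -/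
theorem mem_of_map_mem_map_of_saturated {N : Ideal (MvPolynomial (Fin m) R)}
    (hsat : ∀ (c : R) (φ : MvPolynomial (Fin m) R), c ≠ 0 → C c * φ ∈ N → φ ∈ N)
    {x : MvPolynomial (Fin m) R}
    (hx : MvPolynomial.map (algebraMap R K) x ∈ N.map (MvPolynomial.map (algebraMap R K))) : x ∈ N := by
  classical
  have hinj : Function.Injective (MvPolynomial.map (σ := Fin m) (algebraMap R K)) :=
    map_injective _ (IsFractionRing.injective R K)
  -- every element of `N · K[X]` is `(map n)/d`
  have key : ∀ y ∈ N.map (MvPolynomial.map (algebraMap R K)),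
      ∃ d : R, d ≠ 0 ∧ ∃ n ∈ N, C (algebraMap R K d) * y = MvPolynomial.map (algebraMap R K) n := by
    intro y hy
    refine Submodule.span_induction ?_ ?_ ?_ ?_ hy
    · rintro _ ⟨n, hn, rfl⟩
      exact ⟨1, one_ne_zero, n, hn, by rw [map_one, C_1, one_mul]⟩
    · exact ⟨1, one_ne_zero, 0, N.zero_mem, by rw [mul_zero, map_zero]⟩
    · rintro y z - - ⟨d₁, hd₁, n₁, hn₁, h₁⟩ ⟨d₂, hd₂, n₂, hn₂, h₂⟩
      refine ⟨d₁ * d₂, mul_ne_zero hd₁ hd₂, C d₂ * n₁ + C d₁ * n₂,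
        N.add_mem (N.mul_mem_left _ hn₁) (N.mul_mem_left _ hn₂), ?_⟩
      simp only [map_add, map_mul, map_C]
      rw [← h₁, ← h₂]
      ring
    · rintro g y - ⟨d, hd, n, hn, h⟩
      obtain ⟨dg, hdg, hg, hgeq⟩ := exists_denom_mul_eq_map (R := R) g
      refine ⟨dg * d, mul_ne_zero hdg hd, hg * n, N.mul_mem_left _ hn, ?_⟩
      simp only [smul_eq_mul, map_mul]
      rw [← hgeq, ← h]
      ring
  obtain ⟨d, hd, n, hn, h⟩ := key _ hx
  rw [← map_C, ← map_mul] at h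
  have hxn : C d * x = n := hinj h
  exact hsat d x hd (hxn ▸ hn)

end Fractions

/-! ## `R`-forms of the expansion coefficients `c_α` -/

section Strip

variable {K : Type v} [Field K]

/-- The `R`-form of `c_α(f)` for `f` over `R`: `Σ_{u : u|_V = α} coeff_u(f) X^{u−α}`. Its image over any field is the
`c_α` of `Directrix.lean` applied to the image of `f`. [folklore] -/
private theorem map_stripRForm (ι : R →+* K) (hι : Function.Injective ι) (V : Finset (Fin m)) (α : Fin m →₀ ℕ)
    (f : MvPolynomial (Fin m) R) :
    MvPolynomial.map ι (∑ u ∈ f.support, if u.filter (· ∈ V) = α then monomial (u - α) (coeff u f) else 0) =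
      stripCoeff V α (MvPolynomial.map ι f) := by
  classical
  conv_rhs => rw [(MvPolynomial.map ι f).as_sum, map_sum]
  rw [support_map_of_injective f hι, map_sum]
  refine Finset.sum_congr rfl fun u _ => ?_
  rw [coeff_map, stripCoeff_monomial]
  split_ifs
  · rw [map_monomial]
  · rw [map_zero]

/-- The `R`-form of `c_α(f)` involves only variables of `f` outside `V`. [folklore] -/
private theorem vars_stripRForm_subset (V : Finset (Fin m)) (α : Fin m →₀ ℕ) (f : MvPolynomial (Fin m) R)
    {A : Finset (Fin m)} (hf : f.vars ⊆ A) :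
    (∑ u ∈ f.support, if u.filter (· ∈ V) = α then monomial (u - α) (coeff u f) else 0 :
      MvPolynomial (Fin m) R).vars ⊆ A \ V := by
  classical
  intro i hi
  obtain ⟨d, hd, hid⟩ := (mem_vars_iff_mem_support i).mp hi
  obtain ⟨u, hu, hdu⟩ := Finset.mem_biUnion.mp (support_sum hd)
  split_ifs at hdu with huα
  · have hd' : d = u - α := Finset.mem_singleton.mp (support_monomial_subset hdu)
    subst hd'
    rw [Finsupp.mem_support_iff, Finsupp.tsub_apply] at hid
    have hiV : i ∉ V := by
      intro hiV
      apply hid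
      rw [← huα, Finsupp.filter_apply, if_pos hiV, Nat.sub_self]
    have hui : u i ≠ 0 := fun h0 => hid (by rw [h0, Nat.zero_sub])
    have hiA : i ∈ A := hf ((mem_vars_iff_mem_support i).mpr ⟨u, hu, Finsupp.mem_support_iff.mpr hui⟩)
    exact Finset.mem_sdiff.mpr ⟨hiA, hiV⟩
  · simp at hdu

end Strip

/-! ## Claim 3.9: a saturated ideal generated in the variables `X_A` over `K` is generated in them over `R` -/

section Claim

variable {K : Type v} [Field K] [Algebra R K] [IsFractionRing R K] [IsDomain R]

/-- **CJS Claim 3.9**: let `N ⊆ R[X_1, …, X_m]` be saturated and suppose that its extension `N · K[X]` to the fraction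
field is generated by its elements in the variables `X_i`, `i ∈ A` (`𝒯(N·K[X]) ⊆ ⊕_{i ∈ A} K X_i`, CJS Lemma 2.7). Then
`N` itself is generated by `N ∩ R[X_i : i ∈ A]`: expanding `φ ∈ N` in the monomials of the other variables,
`φ = Σ_α X^α c_α(φ)`, the coefficients `c_α(φ)` lie in `N · K[X]` (Lemma 2.7 over `K`), have coefficients in `R`, hence lie
in `N` by saturation. [cite: CossartJannsenSaito2020, Thm. 3.7 (proof, Claim 3.9)] -/
theorem le_span_inter_supported_of_saturated {N : Ideal (MvPolynomial (Fin m) R)}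
    (hsat : ∀ (c : R) (φ : MvPolynomial (Fin m) R), c ≠ 0 → C c * φ ∈ N → φ ∈ N) (A : Finset (Fin m))
    (hA : N.map (MvPolynomial.map (algebraMap R K)) ≤
      Ideal.span ((N.map (MvPolynomial.map (algebraMap R K)) : Set (MvPolynomial (Fin m) K)) ∩
        (supported K (A : Set (Fin m)) : Set (MvPolynomial (Fin m) K)))) :
    N ≤ Ideal.span ((N : Set (MvPolynomial (Fin m) R)) ∩ (supported R (A : Set (Fin m)) : Set (MvPolynomial (Fin m) R))) := by
  classical
  intro φ hφ
  set ι := algebraMap R K with hι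
  have hinj : Function.Injective ι := IsFractionRing.injective R K
  set V : Finset (Fin m) := Finset.univ \ A with hV
  have hAV : Disjoint A V := Finset.disjoint_sdiff
  set Φ := MvPolynomial.map ι φ with hΦ
  have hΦN : Φ ∈ N.map (MvPolynomial.map ι) := Ideal.mem_map_of_mem _ hφ
  -- the `R`-forms `ψ α` of the coefficients `c_α(Φ)`
  set ψ : (Fin m →₀ ℕ) → MvPolynomial (Fin m) R := fun α =>
    ∑ u ∈ φ.support, if u.filter (· ∈ V) = α then monomial (u - α) (coeff u φ) else 0 with hψ
  have hψmap : ∀ α, MvPolynomial.map ι (ψ α) = stripCoeff V α Φ := fun α => map_stripRForm ι hinj V α φ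
  -- each `ψ α ∈ N ∩ R[X_A]`
  have hψN : ∀ α, ψ α ∈ N := fun α =>
    mem_of_map_mem_map_of_saturated (K := K) hsat
      (by rw [hψmap]; exact stripCoeff_mem_of_le_span V α hAV hA hΦN)
  have hψsupp : ∀ α, ψ α ∈ supported R (A : Set (Fin m)) := fun α => by
    rw [mem_supported]
    intro i hi
    have h := vars_stripRForm_subset V α φ (Finset.subset_univ φ.vars) hi
    rw [Finset.mem_sdiff, hV, Finset.mem_sdiff] at h
    by_contra hiA
    exact h.2 ⟨Finset.mem_univ i, hiA⟩
  -- `φ = Σ_α X^α ψ_α` (checked over `K`)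
  have hsum : ∑ α ∈ φ.support.image (fun u => u.filter (· ∈ V)), monomial α (1 : R) * ψ α = φ := by
    apply map_injective ι hinj
    rw [map_sum]
    simp only [map_mul, map_monomial, map_one, hψmap]
    rw [hΦ, ← support_map_of_injective φ hinj]
    exact sum_monomial_mul_stripCoeff V (MvPolynomial.map ι φ)
  rw [← hsum]
  refine Ideal.sum_mem _ fun α _ => Ideal.mul_mem_left _ _ (Ideal.subset_span ⟨hψN α, hψsupp α⟩)

/-- Hence **every fibre is generated in the variables `X_A`**: for any ring homomorphism `π : R → k` to a field, the
image ideal `N · k[X]` is directed by `⊕_{i ∈ A} k X_i` (CJS Lemma 2.7), so `dim_k 𝒯(N · k[X]) ≤ #A`.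
[cite: CossartJannsenSaito2020, Thm. 3.7 (proof, Lemma 3.8)] -/
theorem finrank_directrixSpace_map_le_card_of_saturated {N : Ideal (MvPolynomial (Fin m) R)}
    (hsat : ∀ (c : R) (φ : MvPolynomial (Fin m) R), c ≠ 0 → C c * φ ∈ N → φ ∈ N) (A : Finset (Fin m))
    (hA : N.map (MvPolynomial.map (algebraMap R K)) ≤
      Ideal.span ((N.map (MvPolynomial.map (algebraMap R K)) : Set (MvPolynomial (Fin m) K)) ∩
        (supported K (A : Set (Fin m)) : Set (MvPolynomial (Fin m) K))))
    {k : Type w} [Field k] (π : R →+* k) :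
    finrank k (directrixSpace (N.map (MvPolynomial.map π))) ≤ A.card := by
  classical
  have hN := le_span_inter_supported_of_saturated (K := K) hsat A hA
  -- the image ideal is generated by the images of `N ∩ R[X_A]`, which lie in `k[X_A]`
  have hdir : Directs (N.map (MvPolynomial.map π)) (Submodule.span k (X '' (A : Set (Fin m)))) := by
    rw [directs_span_X_iff]
    refine Ideal.map_le_iff_le_comap.mpr fun φ hφ => ?_
    rw [Ideal.mem_comap]
    have h1 : MvPolynomial.map π φ ∈ (Ideal.span ((N : Set (MvPolynomial (Fin m) R)) ∩
        (supported R (A : Set (Fin m)) : Set (MvPolynomial (Fin m) R)))).map (MvPolynomial.map π) :=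
      Ideal.mem_map_of_mem _ (hN hφ)
    rw [Ideal.map_span] at h1
    refine Ideal.span_mono ?_ h1
    rintro _ ⟨ψ, ⟨hψN, hψA⟩, rfl⟩
    refine ⟨Ideal.mem_map_of_mem _ hψN, ?_⟩
    have hψA' : ψ.vars ⊆ A := by
      have := mem_supported.mp hψA
      exact fun i hi => by simpa using this hi
    rw [SetLike.mem_coe, mem_supported]
    intro i hi
    exact Finset.mem_coe.mpr (hψA' (vars_map ψ π hi))
  have himg : X '' (A : Set (Fin m)) = ((A.image (X : Fin m → MvPolynomial (Fin m) k) : Finset _) :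
      Set (MvPolynomial (Fin m) k)) := by
    rw [Finset.coe_image]
  haveI : Module.Finite k (Submodule.span k (X '' (A : Set (Fin m)) : Set (MvPolynomial (Fin m) k))) := by
    rw [himg]; exact Module.Finite.span_of_finite k (Finset.finite_toSet _)
  calc finrank k (directrixSpace (N.map (MvPolynomial.map π)))
      ≤ finrank k (Submodule.span k (X '' (A : Set (Fin m)))) := Submodule.finrank_mono (directrixSpace_le hdir)
    _ ≤ A.card := by
        rw [himg]
        exact (finrank_span_finset_le_card _).trans Finset.card_image_le

end Claim


/-! ## Linear substitutions on linear forms; the Smith-adapted coordinate change -/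

section LinSubst

/-- **A linear substitution acts on linear forms through the transposed matrix**:
`σ_a (Σ_i v_i X_i) = Σ_j (Σ_i v_i a_{ij}) X_j`, i.e. `σ_a (linForm v) = linForm (v ᵥ* a)`. [folklore] -/
private theorem linSubst_linForm {F : Type v} [Field F] (a : Matrix (Fin m) (Fin m) F) (v : Fin m → F) :
    linSubst F a (linForm v) = linForm (Matrix.vecMul v a) := by
  rw [linForm_apply, linForm_apply, map_sum]
  simp only [map_smul, linSubst_X, Finset.smul_sum, Matrix.vecMul, dotProduct, Finset.sum_smul]
  rw [Finset.sum_comm]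
  refine Finset.sum_congr rfl fun y _ => Finset.sum_congr rfl fun x _ => ?_
  rw [smul_eq_C_mul, smul_eq_C_mul, ← mul_assoc, ← C_mul]

/-- For a basis `b` of `R^m` and `a = (b.toMatrix e)ᵀ` (`e` the standard basis): `b_l ᵥ* a = e_l`, i.e. the substitution
`σ_a` maps the linear form with coefficient vector `b_l` to the variable `X_l`. [folklore] -/
private theorem vecMul_basis_toMatrix_transpose (b : Basis (Fin m) R (Fin m → R)) (l : Fin m) :
    Matrix.vecMul (b l) ((b.toMatrix (Pi.basisFun R (Fin m))).transpose) = Pi.single l 1 := by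
  classical
  rw [Matrix.vecMul_transpose]
  have hrepr : (⇑((Pi.basisFun R (Fin m)).repr (b l)) : Fin m → R) = b l :=
    funext fun i => by rw [Pi.basisFun_repr]
  rw [← hrepr, Module.Basis.toMatrix_mulVec_repr, Module.Basis.repr_self, Finsupp.single_eq_pi_single]

/-- `σ_b ∘ σ_a = id` when `a b = 1` (linear substitutions, contravariant functoriality). [folklore] -/
private theorem linSubst_linSubst_of_mul_eq_one {a b : Matrix (Fin m) (Fin m) R} (hab : a * b = 1)
    (F : MvPolynomial (Fin m) R) : linSubst R b (linSubst R a F) = F := by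
  rw [← AlgHom.comp_apply, ← linSubst_mul, hab, linSubst_one, AlgHom.id_apply]

/-- **Saturation is preserved by an invertible linear substitution.** [folklore] -/
private theorem saturated_map_linSubst {a b : Matrix (Fin m) (Fin m) R} (hab : a * b = 1) (hba : b * a = 1)
    {N : Ideal (MvPolynomial (Fin m) R)}
    (hsat : ∀ (c : R) (φ : MvPolynomial (Fin m) R), c ≠ 0 → C c * φ ∈ N → φ ∈ N)
    (c : R) (φ : MvPolynomial (Fin m) R) (hc : c ≠ 0)
    (hφ : C c * φ ∈ N.map (linSubst R a : MvPolynomial (Fin m) R →+* MvPolynomial (Fin m) R)) :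
    φ ∈ N.map (linSubst R a : MvPolynomial (Fin m) R →+* MvPolynomial (Fin m) R) := by
  have hsurj : Function.Surjective (linSubst R a : MvPolynomial (Fin m) R →+* MvPolynomial (Fin m) R) :=
    fun y => ⟨linSubst R b y, linSubst_linSubst_of_mul_eq_one hba y⟩
  obtain ⟨x, hx, hxe⟩ := (Ideal.mem_map_iff_of_surjective _ hsurj).mp hφ
  have hx' : x = C c * linSubst R b φ := by
    have := congrArg (linSubst R b) hxe
    rw [RingHom.coe_coe, linSubst_linSubst_of_mul_eq_one hab, map_mul, MvPolynomial.algHom_C,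
      MvPolynomial.algebraMap_eq] at this
    exact this
  have hmem : linSubst R b φ ∈ N := hsat c _ hc (hx' ▸ hx)
  have : linSubst R a (linSubst R b φ) = φ := linSubst_linSubst_of_mul_eq_one hba φ
  rw [← this]
  exact Ideal.mem_map_of_mem _ hmem

/-- Extension of scalars commutes with the linear substitution on ideals:
`(σ_a N) · S[X] = σ_{f(a)} (N · S[X])`. [folklore] -/
private theorem map_map_linSubst_eq {S : Type v} [CommRing S] (f : R →+* S) (a : Matrix (Fin m) (Fin m) R)
    (N : Ideal (MvPolynomial (Fin m) R)) :
    (N.map (linSubst R a : MvPolynomial (Fin m) R →+* MvPolynomial (Fin m) R)).map (MvPolynomial.map f) =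
      (N.map (MvPolynomial.map f)).map (linSubst S (a.map f) : MvPolynomial (Fin m) S →+* MvPolynomial (Fin m) S) := by
  rw [Ideal.map_map, Ideal.map_map]
  congr 1
  exact RingHom.ext fun F => Literature.RingTheory.HilbertSamuel.map_linSubst' f a F

end LinSubst

/-! ## The theorem -/

section Main

variable [IsDomain R] [IsPrincipalIdealRing R] {K : Type v} [Field K] [Algebra R K] [IsFractionRing R K]

/-- **Upper semicontinuity of the directrix space in a saturated family over a principal ideal domain (CJS Lemma 3.8 /
Claim 3.9).** For `N ⊆ R[X_1, …, X_m]` saturated (`c ≠ 0`, `cφ ∈ N ⇒ φ ∈ N`), `K = Frac(R)` and any field-valued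
`π : R → k`: `dim_k 𝒯(N · k[X]) ≤ dim_K 𝒯(N · K[X])`. Proof: `V = 𝒯(N·K[X])`; the lattice `T = {v ∈ R^m : v_K ∈ V}` is
saturated, hence (Smith normal form over the PID `R`) spanned by part of a basis of `R^m`; the corresponding invertible
linear substitution `σ` (over `R`, compatible with `K` and `k`) moves `V` to a coordinate subspace `⊕_{i ∈ A} K X_i`,
`#A = dim V`; `σN` is saturated and `(σN)·K[X]` is directed by `⊕_{i∈A} K X_i`, so by Claim 3.9 `(σN)·k[X]` is directed
by `⊕_{i ∈ A} k X_i`, and `dim 𝒯((σN)·k[X]) = dim 𝒯(N·k[X])`. [cite: CossartJannsenSaito2020, Thm. 3.7 (proof: Lemma 3.8, Claim 3.9, p. 45–46)] -/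
theorem finrank_directrixSpace_map_le_of_saturated {N : Ideal (MvPolynomial (Fin m) R)}
    (hsat : ∀ (c : R) (φ : MvPolynomial (Fin m) R), c ≠ 0 → C c * φ ∈ N → φ ∈ N)
    {k : Type w} [Field k] (π : R →+* k) :
    finrank k (directrixSpace (N.map (MvPolynomial.map π))) ≤
      finrank K (directrixSpace (N.map (MvPolynomial.map (algebraMap R K)))) := by
  classical
  set ι := algebraMap R K with hιdef
  have hinj : Function.Injective ι := IsFractionRing.injective R K
  set NK := N.map (MvPolynomial.map ι) with hNK
  set V := directrixSpace NK with hVdef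
  have hV : Directs NK V := directs_directrixSpace NK
  -- the lattice `T = {v ∈ R^m : Σ ι(v_i) X_i ∈ V}`
  let T : Submodule R (Fin m → R) :=
    { carrier := {v | (linForm fun i => ι (v i) : MvPolynomial (Fin m) K) ∈ V}
      add_mem' := by
        intro v w hv hw
        have : (linForm fun i => ι ((v + w) i) : MvPolynomial (Fin m) K) =
            linForm (fun i => ι (v i)) + linForm (fun i => ι (w i)) := by
          rw [← map_add]; congr 1; funext i; exact map_add ι _ _
        show (linForm fun i => ι ((v + w) i) : MvPolynomial (Fin m) K) ∈ V
        rw [this]; exact V.add_mem hv hw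
      zero_mem' := by
        show (linForm fun i => ι ((0 : Fin m → R) i) : MvPolynomial (Fin m) K) ∈ V
        have : (fun i => ι ((0 : Fin m → R) i)) = 0 := funext fun i => by simp
        rw [this, map_zero]; exact V.zero_mem
      smul_mem' := by
        intro c v hv
        have : (linForm fun i => ι ((c • v) i) : MvPolynomial (Fin m) K) = ι c • linForm (fun i => ι (v i)) := by
          rw [← map_smul]; congr 1; funext i
          rw [Pi.smul_apply, Pi.smul_apply, smul_eq_mul, smul_eq_mul, map_mul]
        show (linForm fun i => ι ((c • v) i) : MvPolynomial (Fin m) K) ∈ V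
        rw [this]; exact V.smul_mem _ hv }
  have hTmem : ∀ v : Fin m → R, v ∈ T ↔ (linForm fun i => ι (v i) : MvPolynomial (Fin m) K) ∈ V := fun _ => Iff.rfl
  -- `T` is saturated
  have hTsat : ∀ (c : R) (v : Fin m → R), c ≠ 0 → c • v ∈ T → v ∈ T := by
    intro c v hc hcv
    rw [hTmem] at hcv ⊢
    have h1 : (linForm fun i => ι ((c • v) i) : MvPolynomial (Fin m) K) = ι c • linForm (fun i => ι (v i)) := by
      rw [← map_smul]; congr 1; funext i
      rw [Pi.smul_apply, Pi.smul_apply, smul_eq_mul, smul_eq_mul, map_mul]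
    rw [h1] at hcv
    exact (V.smul_mem_iff ((map_ne_zero_iff ι hinj).mpr hc)).mp hcv
  -- Smith normal form
  obtain ⟨t, bM, bT, f, a, hsnf⟩ := Submodule.smithNormalForm (Pi.basisFun R (Fin m)) T
  have ha : ∀ i, a i ≠ 0 := by
    intro i h0
    have := hsnf i
    rw [h0, zero_smul] at this
    exact bT.ne_zero i (Subtype.ext this)
  -- (i) the basis vectors `bM (f i)` lie in `T`
  have hbMT : ∀ i, bM (f i) ∈ T := fun i =>
    hTsat (a i) _ (ha i) (by rw [← hsnf i]; exact (bT i).2)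
  -- (ii) `V` is the `K`-span of their images
  set w : Fin t → MvPolynomial (Fin m) K := fun i => linForm fun j => ι (bM (f i) j) with hw
  have hwV : ∀ i, w i ∈ V := fun i => (hTmem _).mp (hbMT i)
  have hTspan : ∀ v ∈ T, (linForm fun i => ι (v i) : MvPolynomial (Fin m) K) ∈
      Submodule.span K (Set.range w) := by
    intro v hv
    set c : Fin t →₀ R := bT.repr ⟨v, hv⟩ with hc
    have hrepr := congrArg (fun x : T => (x : Fin m → R)) (bT.sum_repr ⟨v, hv⟩)
    simp only [Submodule.coe_sum, Submodule.coe_smul_of_tower] at hrepr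
    have hv' : v = ∑ i, (c i * a i) • bM (f i) := by
      rw [← hrepr]
      exact Finset.sum_congr rfl fun i _ => by rw [hsnf i, smul_smul]
    have hfun : (fun j => ι (v j)) = ∑ i, ι (c i * a i) • fun j => ι (bM (f i) j) := by
      funext j
      conv_lhs => rw [hv']
      simp only [Finset.sum_apply, Pi.smul_apply, smul_eq_mul, map_sum, map_mul]
    have hlin : (linForm fun j => ι (v j) : MvPolynomial (Fin m) K) = ∑ i, ι (c i * a i) • w i := by
      rw [hfun, map_sum]
      exact Finset.sum_congr rfl fun i _ => by rw [map_smul]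
    rw [hlin]
    exact Submodule.sum_mem _ fun i _ => Submodule.smul_mem _ _ (Submodule.subset_span ⟨i, rfl⟩)
  have hVle : V ≤ Submodule.span K (Set.range w) := by
    intro v hv
    -- `v = Σ κ_i X_i`; clear denominators
    obtain ⟨κ, rfl⟩ : ∃ κ : Fin m → K, linForm κ = v := by
      have : v ∈ LinearMap.range (linForm (K := K) (n := m)) := by
        rw [range_linForm]; exact directrixSpace_le_one NK hv
      exact LinearMap.mem_range.mp this
    obtain ⟨d, hd⟩ := IsLocalization.exist_integer_multiples_of_finite (nonZeroDivisors R) κ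
    choose r hr using hd
    have hdne : (d : R) ≠ 0 := nonZeroDivisors.ne_zero d.2
    have hrT : r ∈ T := by
      rw [hTmem]
      have : (fun i => ι (r i)) = (ι d) • κ := by
        funext i; rw [hr i, Pi.smul_apply, Algebra.smul_def, smul_eq_mul]
      rw [this, map_smul]
      exact V.smul_mem _ hv
    have h1 := hTspan r hrT
    have h2 : (linForm fun i => ι (r i) : MvPolynomial (Fin m) K) = ι d • linForm κ := by
      have : (fun i => ι (r i)) = (ι d) • κ := by
        funext i; rw [hr i, Pi.smul_apply, Algebra.smul_def, smul_eq_mul]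
      rw [this, map_smul]
    rw [h2] at h1
    have hιd : ι d ≠ 0 := (map_ne_zero_iff ι hinj).mpr hdne
    have := Submodule.smul_mem _ (ι d)⁻¹ h1
    rwa [smul_smul, inv_mul_cancel₀ hιd, one_smul] at this
  -- the coordinate change
  set e := Pi.basisFun R (Fin m) with he
  set aR : Matrix (Fin m) (Fin m) R := (bM.toMatrix e).transpose with haR
  set bR : Matrix (Fin m) (Fin m) R := (e.toMatrix bM).transpose with hbR
  have hab : aR * bR = 1 := by
    rw [haR, hbR, ← Matrix.transpose_mul, Module.Basis.toMatrix_mul_toMatrix_flip, Matrix.transpose_one]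
  have hba : bR * aR = 1 := by
    rw [haR, hbR, ← Matrix.transpose_mul, Module.Basis.toMatrix_mul_toMatrix_flip, Matrix.transpose_one]
  have habK : aR.map ι * bR.map ι = 1 := by
    rw [← Matrix.map_mul, hab]; exact Matrix.map_one _ (map_zero _) (map_one _)
  have hbaK : bR.map ι * aR.map ι = 1 := by
    rw [← Matrix.map_mul, hba]; exact Matrix.map_one _ (map_zero _) (map_one _)
  have habk : aR.map π * bR.map π = 1 := by
    rw [← Matrix.map_mul, hab]; exact Matrix.map_one _ (map_zero _) (map_one _)
  have hbak : bR.map π * aR.map π = 1 := by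
    rw [← Matrix.map_mul, hba]; exact Matrix.map_one _ (map_zero _) (map_one _)
  -- `σ_K (w_i) = X_{f i}`
  have hσw : ∀ i, linSubst K (aR.map ι) (w i) = X (f i) := by
    intro i
    rw [hw, linSubst_linForm]
    have : Matrix.vecMul (fun j => ι (bM (f i) j)) (aR.map ι) = Pi.single (f i) 1 := by
      funext j
      have h := (RingHom.map_vecMul ι aR (bM (f i)) j).symm
      rw [show (⇑ι ∘ bM (f i)) = fun j => ι (bM (f i) j) from rfl] at h
      rw [h, haR, vecMul_basis_toMatrix_transpose]
      by_cases hj : j = f i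
      · subst hj; simp
      · simp [hj]
    rw [this, linForm_single]
  -- the substituted ideal `N₁ = σ N` and its properties
  set N₁ := N.map (linSubst R aR : MvPolynomial (Fin m) R →+* MvPolynomial (Fin m) R) with hN₁
  have hsat₁ : ∀ (c : R) (φ : MvPolynomial (Fin m) R), c ≠ 0 → C c * φ ∈ N₁ → φ ∈ N₁ :=
    fun c φ hc hφ => saturated_map_linSubst hab hba hsat c φ hc hφ
  set A : Finset (Fin m) := Finset.univ.map f with hA
  have hAcard : A.card = t := by rw [hA, Finset.card_map, Finset.card_univ, Fintype.card_fin]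
  -- the `K`-side: `𝒯((σN)·K[X]) = σ_K V = ⊕_{i ∈ A} K X_i`
  set θK := Literature.RingTheory.HilbertSamuel.linSubstEquiv habK hbaK with hθK
  have hθK1 : ∀ g : MvPolynomial (Fin m) K, g.IsHomogeneous 1 → (θK g).IsHomogeneous 1 :=
    fun g hg => isHomogeneous_linSubst _ hg
  have hN₁K : N₁.map (MvPolynomial.map ι) = NK.map (θK : MvPolynomial (Fin m) K →+* MvPolynomial (Fin m) K) := by
    rw [hN₁, map_map_linSubst_eq]; rfl
  have hVmap : V.map θK.toLinearMap = Submodule.span K (X '' (A : Set (Fin m))) := by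
    apply le_antisymm
    · rintro _ ⟨v, hv, rfl⟩
      have hv' := hVle hv
      rw [Submodule.mem_span_range_iff_exists_fun] at hv'
      obtain ⟨c, rfl⟩ := hv'
      rw [map_sum]
      refine Submodule.sum_mem _ fun i _ => ?_
      rw [map_smul]
      refine Submodule.smul_mem _ _ (Submodule.subset_span ⟨f i, ?_, ?_⟩)
      · simp [hA]
      · change X (f i) = linSubst K (aR.map ι) (w i); rw [hσw]
    · refine Submodule.span_le.mpr ?_
      rintro _ ⟨j, hj, rfl⟩
      have hj' : j ∈ Set.range f := by simpa [hA] using hj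
      obtain ⟨i, rfl⟩ := hj'
      exact ⟨w i, hwV i, hσw i⟩
  have hdirK : Directs (NK.map (θK : MvPolynomial (Fin m) K →+* MvPolynomial (Fin m) K))
      (Submodule.span K (X '' (A : Set (Fin m)))) := by
    have h := hV.map_algEquiv θK hθK1
    rwa [hVmap] at h
  have hAK : N₁.map (MvPolynomial.map ι) ≤
      Ideal.span ((N₁.map (MvPolynomial.map ι) : Set (MvPolynomial (Fin m) K)) ∩
        (supported K (A : Set (Fin m)) : Set (MvPolynomial (Fin m) K))) := by
    rw [hN₁K]; exact (directs_span_X_iff _).mp hdirK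
  -- Claim 3.9 on `N₁`: the `k`-fibre is generated in the variables of `A`
  have hk : finrank k (directrixSpace (N₁.map (MvPolynomial.map π))) ≤ A.card :=
    finrank_directrixSpace_map_le_card_of_saturated (K := K) hsat₁ A hAK π
  -- back to `N`: the `k`-side coordinate change
  set θk := Literature.RingTheory.HilbertSamuel.linSubstEquiv habk hbak with hθk
  have hN₁k : N₁.map (MvPolynomial.map π) =
      (N.map (MvPolynomial.map π)).map (θk : MvPolynomial (Fin m) k →+* MvPolynomial (Fin m) k) := by
    rw [hN₁, map_map_linSubst_eq]; rfl
  have hfk : finrank k (directrixSpace (N₁.map (MvPolynomial.map π))) =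
      finrank k (directrixSpace (N.map (MvPolynomial.map π))) := by
    rw [hN₁k, directrixSpace_map_algEquiv θk (fun g hg => isHomogeneous_linSubst _ hg)
      (fun g hg => isHomogeneous_linSubst _ hg)]
    exact (LinearEquiv.finrank_eq (Submodule.equivMapOfInjective θk.toLinearMap θk.injective _)).symm
  have hfK : finrank K V = A.card := by
    have h1 : finrank K (V.map θK.toLinearMap) = finrank K V :=
      (LinearEquiv.finrank_eq (Submodule.equivMapOfInjective θK.toLinearMap θK.injective _)).symm
    rw [← h1, hVmap]
    have hli : LinearIndependent K (fun j : (A : Set (Fin m)) => (X (j : Fin m) : MvPolynomial (Fin m) K)) :=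
      linearIndependent_X.comp _ Subtype.val_injective
    have hrange : Set.range (fun j : (A : Set (Fin m)) => (X (j : Fin m) : MvPolynomial (Fin m) K)) =
        X '' (A : Set (Fin m)) := by
      ext g; simp
    rw [← hrange, finrank_span_eq_card hli]
    simp
  rw [← hfk, hfK]
  exact hk

end Main

end Literature.RingTheory.MvPolynomial

end
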